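import Literature.Topology.FourManifolds.LefschetzBaseRegular
import Literature.Topology.FourManifolds.RegularFamilyDirectedIsotopy
import HarnessLib

/-!
# Changing the cut-off profile of the Lefschetz base by a diffeomorphism preserving `w`

Topic `Literature/Topology/FourManifolds`; namespace `Literature.Topology.FourManifolds.LefschetzBase`.
A sequel of `LefschetzBaseRegular.lean` (the base `Base g = {rho g ≤ 1/4} ⊂ ℂ²`,
`rho g = ‖w‖² + eta(‖x‖²)`, `w = y² - x^{2g+1} - 1`) and the first application of the directed
isotopy lemma `RegularFamily.exists_diffeomorph_image_eq_of_field_on`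
(`RegularFamilyDirectedIsotopy.lean`).  Everything here is **proved**; the two definitions
(`horizontalField`, `profileFamily`) are auxiliary and explicit, no named fact is introduced.

**Why.**  The base case of the named fact
`Literature.Geometry.Symplectic.palf_stein_supportedByBoundaryOpenBook` (a Stein structure on
`Base g` whose boundary complex tangencies are supported by the Kas open book
`({w = 0}, w/‖w‖)`; design note in `Literature/Geometry/Symplectic/LefschetzSteinRealisationReduction.lean`)
asks for an identification of `Base g` with a strictly pseudoconvex model `{Ψ ≤ 1/4} ⊂ ℂ²`
which preserves the page angle `w/‖w‖` and the binding `{w = 0}` on the boundary.  The cut-off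
`eta(s) = exp(-1/(s - 4))` is NOT convex for `s - 4 > 1/2` (`eta'' = eta (1 - 2u)/u⁴`,
`u = s - 4`), and `eta(‖x‖²)` is not plurisubharmonic there, so the model must use another
profile `η₁` (convex, non-decreasing) in place of `eta`.  This file performs that change of
profile: **for every smooth profile `η₁ ≥ eta` which agrees with `eta` on `s ≤ s₀` (`s₀ > 4`)
and has positive derivative on `s ≥ s₀`, there is a diffeomorphism `Φ` of `ℝ⁴ = ℂ²` with
`Φ {rho g ≤ 1/4} = {‖w‖² + η₁(‖x‖²) ≤ 1/4}`, `Φ {rho g = 1/4} = {‖w‖² + η₁(‖x‖²) = 1/4}`,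
`w ∘ Φ = w` (so the pages `{w = c}` and the binding `{w = 0}` are preserved individually) and
`Φ = id` on `{‖x‖² < s₀}`** (`exists_diffeomorph_profileChange`).

**How.**  The family `F_τ = ‖w‖² + eta(‖x‖²) + τ (η₁ - eta)(‖x‖²) - 1/4` moves only inside
`C = {‖x‖² ≥ s₀}`; the HORIZONTAL field
`Y(x, y) = (-2 ‖y‖² x, -ȳ x p'(x))`, `p'(x) = (2g+1) x^{2g}`, lies in the kernel of
`dw = -p'(x) dx + 2y dy` (so `w` is a conserved quantity) and satisfies
`d(‖x‖²)(Y) = -4 ‖x‖² ‖y‖²`, whence `dF_τ(Y) = -4 η_τ'(‖x‖²) ‖x‖² ‖y‖² < 0` on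
`C ∩ {F_τ = 0}` (there `‖x‖² ≥ s₀ > 4`, `η_τ' = (1 - τ) eta' + τ η₁' > 0`, and `y ≠ 0` because
`y = 0` forces `‖w‖ = ‖x^{2g+1} + 1‖ > 1`); off `C` the field is merely tangent to the flat part
`{‖w‖ = 1/2}` of the hypersurfaces, which does not move.  The directed isotopy lemma with moving
set `C` gives `Φ`, and its orbit clause with `RegularFamily.apply_eq_apply_of_hasDerivAt_smul`
gives `w ∘ Φ = w`.

## References

* J. Milnor, *Morse theory*, Ann. of Math. Studies 51 (1963), Thm. 3.1. [Milnor1963]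
* J. B. Etnyre, T. Fuller, *Realizing 4-manifolds as achiral Lefschetz fibrations*, IMRN 2006,
  §2 (the base `F × D²`). [EtnyreFuller2006]
-/

noncomputable section

open scoped Manifold ContDiff Topology ComplexConjugate
open Set Function Metric Filter

namespace Literature.Topology.FourManifolds

namespace LefschetzBase

/-! ### §1 Coordinates and `w` along a line in a general direction -/

/-- `x`-coordinate along the line `t ↦ p + t (a, b)`. [folklore] -/
@[simp] theorem cx_line (p : EuclideanSpace ℝ (Fin 4)) (a b : ℂ) (t : ℝ) : cx (p + t • mk a b) = cx p + t * a := by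
  simp [cx_add, cx_smul]

/-- `y`-coordinate along the line `t ↦ p + t (a, b)`. [folklore] -/
@[simp] theorem cy_line (p : EuclideanSpace ℝ (Fin 4)) (a b : ℂ) (t : ℝ) : cy (p + t • mk a b) = cy p + t * b := by
  simp [cy_add, cy_smul]

/-- **`dw = -p'(x) dx + 2y dy`**: the derivative of `w` along the line `t ↦ p + t (a, b)` at
`t = 0` is `2 b y - (2g+1) x^{2g} a`. [folklore] -/
theorem hasDerivAt_w_line (g : ℕ) (p : EuclideanSpace ℝ (Fin 4)) (a b : ℂ) :
    HasDerivAt (fun t : ℝ => w g (p + t • mk a b))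
      (2 * b * cy p - (2 * g + 1 : ℕ) * cx p ^ (2 * g) * a) 0 := by
  have hy : HasDerivAt (fun t : ℝ => (cy p + (t : ℂ) * b) ^ 2)
      ((2 : ℕ) * (cy p + ((0 : ℝ) : ℂ) * b) ^ (2 - 1) * (1 * b)) 0 :=
    (((hasDerivAt_ofReal' 0).mul_const b).const_add (cy p)).pow 2
  have hx : HasDerivAt (fun t : ℝ => (cx p + (t : ℂ) * a) ^ (2 * g + 1))
      ((2 * g + 1 : ℕ) * (cx p + ((0 : ℝ) : ℂ) * a) ^ (2 * g + 1 - 1) * (1 * a)) 0 :=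
    (((hasDerivAt_ofReal' 0).mul_const a).const_add (cx p)).pow (2 * g + 1)
  have h := (hy.sub hx).sub_const 1
  have hfun : (fun t : ℝ => w g (p + t • mk a b)) =
      fun t : ℝ => (cy p + (t : ℂ) * b) ^ 2 - (cx p + (t : ℂ) * a) ^ (2 * g + 1) - 1 := by
    funext t
    simp only [w, Phi, cx_line, cy_line]
  rw [hfun]
  refine h.congr_deriv ?_
  simp
  ring

/-- `‖x‖²` along the line `t ↦ p + t (a, b)`: derivative `2 Re(x̄ a)` at `t = 0`. [folklore] -/
theorem hasDerivAt_norm_sq_cx_line (p : EuclideanSpace ℝ (Fin 4)) (a b : ℂ) :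
    HasDerivAt (fun t : ℝ => ‖cx (p + t • mk a b)‖ ^ 2) (2 * (conj (cx p) * a).re) 0 := by
  have h : HasDerivAt (fun t : ℝ => cx p + (t : ℂ) * a) (1 * a) 0 :=
    ((hasDerivAt_ofReal' 0).mul_const a).const_add (cx p)
  have h' := hasDerivAt_norm_sq_comp h
  have hfun : (fun t : ℝ => ‖cx (p + t • mk a b)‖ ^ 2) = fun t : ℝ => ‖cx p + (t : ℂ) * a‖ ^ 2 := by
    funext t; rw [cx_line]
  rw [hfun]
  refine h'.congr_deriv ?_
  simp

/-- `mk` of two smooth complex-valued functions is smooth (`mk` is real linear). [folklore] -/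
theorem contDiff_mk_comp {X : Type*} [NormedAddCommGroup X] [NormedSpace ℝ X] {a b : X → ℂ}
    (ha : ContDiff ℝ ∞ a) (hb : ContDiff ℝ ∞ b) : ContDiff ℝ ∞ fun x => mk (a x) (b x) := by
  rw [contDiff_euclidean]
  intro i
  fin_cases i
  · exact (Complex.reCLM.contDiff.comp ha)
  · exact (Complex.imCLM.contDiff.comp ha)
  · exact (Complex.reCLM.contDiff.comp hb)
  · exact (Complex.imCLM.contDiff.comp hb)

/-- `p ↦ conj (cy p)` is smooth. [folklore] -/
theorem contDiff_conj_cy : ContDiff ℝ ∞ fun p : EuclideanSpace ℝ (Fin 4) => conj (cy p) := by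
  have h : ContDiff ℝ ∞ fun p : EuclideanSpace ℝ (Fin 4) => Complex.conjCLE (cy p) := Complex.conjCLE.contDiff.comp contDiff_cy
  simpa only [Complex.conjCLE_apply] using h

/-! ### §2 The horizontal field `Y = (-2‖y‖² x, -ȳ x p'(x)) ∈ ker dw` -/

/-- **The horizontal field** `Y(x, y) = (-2 ‖y‖² x, -ȳ x p'(x))`, `p'(x) = (2g+1) x^{2g}`: a
polynomial vector field on `ℝ⁴ = ℂ²` tangent to the fibres of `w = y² - x^{2g+1} - 1`
(`dw(Y) = -p'(x)(-2‖y‖² x) + 2y(-ȳ x p'(x)) = 0`) along which `‖x‖²` decreases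
(`d‖x‖²(Y) = -4‖x‖²‖y‖²`). [folklore] -/
def horizontalField (g : ℕ) (p : EuclideanSpace ℝ (Fin 4)) : EuclideanSpace ℝ (Fin 4) :=
  mk (-(2 * (conj (cy p) * cy p) * cx p))
    (-(conj (cy p) * cx p * ((2 * g + 1 : ℕ) * cx p ^ (2 * g))))

/-- The horizontal field is smooth. [folklore] -/
theorem contDiff_horizontalField (g : ℕ) : ContDiff ℝ ∞ (horizontalField g) := by
  unfold horizontalField
  refine contDiff_mk_comp ?_ ?_
  · exact ((contDiff_const.mul (contDiff_conj_cy.mul contDiff_cy)).mul contDiff_cx).neg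
  · exact ((contDiff_conj_cy.mul contDiff_cx).mul
      (contDiff_const.mul (contDiff_cx.pow _))).neg

/-- **`w` is constant along the horizontal field**: `t ↦ w(p + t Y(p))` has derivative `0` at
`t = 0`. [folklore] -/
theorem hasDerivAt_w_horizontalField (g : ℕ) (p : EuclideanSpace ℝ (Fin 4)) :
    HasDerivAt (fun t : ℝ => w g (p + t • horizontalField g p)) 0 0 := by
  have h := hasDerivAt_w_line g p (-(2 * (conj (cy p) * cy p) * cx p))
    (-(conj (cy p) * cx p * ((2 * g + 1 : ℕ) * cx p ^ (2 * g))))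
  refine h.congr_deriv ?_
  ring

/-- **`dw(Y) = 0`** as a statement on the Fréchet derivative. [folklore] -/
theorem fderiv_w_horizontalField (g : ℕ) (p : EuclideanSpace ℝ (Fin 4)) :
    fderiv ℝ (w g) p (horizontalField g p) = 0 := by
  have hl : HasDerivAt (fun t : ℝ => p + t • horizontalField g p) (horizontalField g p) 0 := by
    have h := ((hasDerivAt_id (0 : ℝ)).smul_const (horizontalField g p)).const_add p
    rw [one_smul] at h
    exact h
  have h1 : HasDerivAt (fun t : ℝ => w g (p + t • horizontalField g p))
      (fderiv ℝ (w g) p (horizontalField g p)) 0 := by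
    have h := (((contDiff_w g).differentiable (by simp)) (p + (0 : ℝ) • horizontalField g p)).hasFDerivAt.comp_hasDerivAt (0 : ℝ) hl
    rw [zero_smul, add_zero] at h
    exact h
  exact h1.unique (hasDerivAt_w_horizontalField g p)

/-- **`‖x‖²` decreases along the horizontal field**: derivative `-4 ‖x‖² ‖y‖²`. [folklore] -/
theorem hasDerivAt_norm_sq_cx_horizontalField (g : ℕ) (p : EuclideanSpace ℝ (Fin 4)) :
    HasDerivAt (fun t : ℝ => ‖cx (p + t • horizontalField g p)‖ ^ 2)
      (-(4 * ‖cx p‖ ^ 2 * ‖cy p‖ ^ 2)) 0 := by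
  have h := hasDerivAt_norm_sq_cx_line p (-(2 * (conj (cy p) * cy p) * cx p))
    (-(conj (cy p) * cx p * ((2 * g + 1 : ℕ) * cx p ^ (2 * g))))
  refine h.congr_deriv ?_
  have key : conj (cx p) * -(2 * (conj (cy p) * cy p) * cx p) =
      -(2 * ((conj (cx p) * cx p) * (conj (cy p) * cy p))) := by ring
  rw [key, Complex.conj_mul', Complex.conj_mul', ← Complex.ofReal_pow, ← Complex.ofReal_pow]
  norm_cast
  ring

/-! ### §3 The family interpolating the profiles -/

/-- **The profile-change family** `F(τ, p) = ‖w p‖² + (eta + τ (η₁ - eta))(‖x‖²) - 1/4`: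
`F(0, ·) = rho g - 1/4` and `F(1, ·) = ‖w‖² + η₁(‖x‖²) - 1/4`. [folklore] -/
def profileFamily (g : ℕ) (η₁ : ℝ → ℝ) (q : ℝ × EuclideanSpace ℝ (Fin 4)) : ℝ :=
  ‖w g q.2‖ ^ 2 + (eta (‖cx q.2‖ ^ 2) + q.1 * (η₁ (‖cx q.2‖ ^ 2) - eta (‖cx q.2‖ ^ 2))) - 1 / 4

section Family

variable (g : ℕ) {η₁ : ℝ → ℝ}

/-- `F(0, ·) = rho g - 1/4`. [folklore] -/
theorem profileFamily_zero (p : EuclideanSpace ℝ (Fin 4)) : profileFamily g η₁ (0, p) = rho g p - 1 / 4 := by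
  simp [profileFamily, rho]

/-- `F(1, ·) = ‖w‖² + η₁(‖x‖²) - 1/4`. [folklore] -/
theorem profileFamily_one (p : EuclideanSpace ℝ (Fin 4)) :
    profileFamily g η₁ (1, p) = ‖w g p‖ ^ 2 + η₁ (‖cx p‖ ^ 2) - 1 / 4 := by
  simp [profileFamily]

/-- The family is smooth when the profile is. [folklore] -/
theorem contDiff_profileFamily (hη₁ : ContDiff ℝ ∞ η₁) : ContDiff ℝ ∞ (profileFamily g η₁) := by
  unfold profileFamily
  have hs : ContDiff ℝ ∞ fun q : ℝ × EuclideanSpace ℝ (Fin 4) => ‖cx q.2‖ ^ 2 :=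
    contDiff_norm_sq_complex.comp (contDiff_cx.comp contDiff_snd)
  exact (((contDiff_norm_sq_complex.comp ((contDiff_w g).comp contDiff_snd)).add
    ((contDiff_eta.comp hs).add (contDiff_fst.mul ((hη₁.comp hs).sub (contDiff_eta.comp hs))))).sub
      contDiff_const)

/-- `F(τ, p) ≥ rho g p - 1/4` for `τ ≥ 0` when `η₁ ≥ eta`. [folklore] -/
theorem rho_sub_le_profileFamily (hge : ∀ s, eta s ≤ η₁ s) {τ : ℝ} (hτ : 0 ≤ τ) (p : EuclideanSpace ℝ (Fin 4)) :
    rho g p - 1 / 4 ≤ profileFamily g η₁ (τ, p) := by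
  have h : 0 ≤ τ * (η₁ (‖cx p‖ ^ 2) - eta (‖cx p‖ ^ 2)) :=
    mul_nonneg hτ (sub_nonneg.2 (hge _))
  simp only [profileFamily, rho]
  linarith

/-- The time derivative of the family: `∂_τ F(τ, p) = η₁(‖x‖²) - eta(‖x‖²)`. [folklore] -/
theorem fderiv_profileFamily_time (hη₁ : ContDiff ℝ ∞ η₁) (τ : ℝ) (p : EuclideanSpace ℝ (Fin 4)) :
    fderiv ℝ (profileFamily g η₁) (τ, p) (1, 0) = η₁ (‖cx p‖ ^ 2) - eta (‖cx p‖ ^ 2) := by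
  set c : ℝ := η₁ (‖cx p‖ ^ 2) - eta (‖cx p‖ ^ 2) with hc
  -- the explicit derivative of the affine function `σ ↦ F(σ, p)`
  have h1 : HasDerivAt (fun σ : ℝ => profileFamily g η₁ (σ, p)) c τ := by
    have h : HasDerivAt (fun σ : ℝ => σ * c) c τ := by simpa using (hasDerivAt_id τ).mul_const c
    exact ((h.const_add (eta (‖cx p‖ ^ 2))).const_add (‖w g p‖ ^ 2)).sub_const (1 / 4)
  -- the same derivative through the Fréchet derivative
  have hFd : DifferentiableAt ℝ (profileFamily g η₁) (τ, p) :=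
    (contDiff_profileFamily g hη₁).differentiable (by simp) _
  have hcurve : HasDerivAt (fun σ : ℝ => ((σ, p) : ℝ × EuclideanSpace ℝ (Fin 4))) ((1 : ℝ), (0 : EuclideanSpace ℝ (Fin 4))) τ :=
    (hasDerivAt_id τ).prodMk (hasDerivAt_const τ p)
  have h2 : HasDerivAt ((profileFamily g η₁) ∘ fun σ : ℝ => ((σ, p) : ℝ × EuclideanSpace ℝ (Fin 4)))
      (fderiv ℝ (profileFamily g η₁) (τ, p) ((1 : ℝ), (0 : EuclideanSpace ℝ (Fin 4)))) τ :=
    hFd.hasFDerivAt.comp_hasDerivAt τ hcurve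
  exact h2.unique h1

/-- **The directional derivative of `F_τ` along the horizontal field**:
`dF_τ(Y)(p) = -4 ((1 - τ) eta' + τ η₁')(‖x‖²) ‖x‖² ‖y‖²`. [folklore] -/
theorem hasDerivAt_profileFamily_horizontalField (hη₁ : ContDiff ℝ ∞ η₁) (τ : ℝ) (p : EuclideanSpace ℝ (Fin 4)) :
    HasDerivAt (fun t : ℝ => profileFamily g η₁ (τ, p + t • horizontalField g p))
      (-(4 * ‖cx p‖ ^ 2 * ‖cy p‖ ^ 2) *
        ((1 - τ) * deriv eta (‖cx p‖ ^ 2) + τ * deriv η₁ (‖cx p‖ ^ 2))) 0 := by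
  set v := horizontalField g p with hv
  set D : ℝ := -(4 * ‖cx p‖ ^ 2 * ‖cy p‖ ^ 2) with hD
  -- `‖w‖²` is constant to first order
  have h1 : HasDerivAt (fun t : ℝ => ‖w g (p + t • v)‖ ^ 2) 0 0 := by
    have h := hasDerivAt_norm_sq_comp (hasDerivAt_w_horizontalField g p)
    simpa using h
  -- `‖x‖²`
  have h2 : HasDerivAt (fun t : ℝ => ‖cx (p + t • v)‖ ^ 2) D 0 :=
    hasDerivAt_norm_sq_cx_horizontalField g p
  have h20 : ‖cx (p + (0 : ℝ) • v)‖ ^ 2 = ‖cx p‖ ^ 2 := by rw [zero_smul, add_zero]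
  -- the profiles
  have heta : HasDerivAt (fun t : ℝ => eta (‖cx (p + t • v)‖ ^ 2)) (deriv eta (‖cx p‖ ^ 2) * D) 0 := by
    have hd : HasDerivAt eta (deriv eta (‖cx (p + (0 : ℝ) • v)‖ ^ 2)) (‖cx (p + (0 : ℝ) • v)‖ ^ 2) :=
      ((contDiff_eta.differentiable (by simp)) _).hasDerivAt
    have h := hd.comp 0 h2
    rwa [h20] at h
  have hη : HasDerivAt (fun t : ℝ => η₁ (‖cx (p + t • v)‖ ^ 2)) (deriv η₁ (‖cx p‖ ^ 2) * D) 0 := by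
    have hd : HasDerivAt η₁ (deriv η₁ (‖cx (p + (0 : ℝ) • v)‖ ^ 2)) (‖cx (p + (0 : ℝ) • v)‖ ^ 2) :=
      ((hη₁.differentiable (by simp)) _).hasDerivAt
    have h := hd.comp 0 h2
    rwa [h20] at h
  have h := (h1.add (heta.add ((hη.sub heta).const_mul τ))).sub_const (1 / 4)
  refine h.congr_deriv ?_
  ring

/-- The directional derivative as a value of the Fréchet derivative of `F_τ`. [folklore] -/
theorem fderiv_profileFamily_horizontalField (hη₁ : ContDiff ℝ ∞ η₁) (τ : ℝ) (p : EuclideanSpace ℝ (Fin 4)) :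
    fderiv ℝ (fun q => profileFamily g η₁ (τ, q)) p (horizontalField g p) =
      -(4 * ‖cx p‖ ^ 2 * ‖cy p‖ ^ 2) *
        ((1 - τ) * deriv eta (‖cx p‖ ^ 2) + τ * deriv η₁ (‖cx p‖ ^ 2)) := by
  have hdiff : Differentiable ℝ fun q => profileFamily g η₁ (τ, q) :=
    ((contDiff_profileFamily g hη₁).comp (contDiff_const.prodMk contDiff_id)).differentiable
      (by simp)
  exact (hasDerivAt_comp_line hdiff p (horizontalField g p)).unique
    (hasDerivAt_profileFamily_horizontalField g hη₁ τ p)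

/-- **On the zero set of `F_τ` over `‖x‖² > 4` one has `y ≠ 0`**: if `y = 0` then
`w = -(x^{2g+1} + 1)` has norm `> 1`, so `F_τ ≥ ‖w‖² - 1/4 > 0`. [folklore] -/
theorem cy_ne_zero_of_profileFamily_eq_zero (hge : ∀ s, eta s ≤ η₁ s) {τ : ℝ} (hτ : 0 ≤ τ)
    {p : EuclideanSpace ℝ (Fin 4)} (hF : profileFamily g η₁ (τ, p) = 0) (hx : 4 < ‖cx p‖ ^ 2) : cy p ≠ 0 := by
  intro hy
  have hx1 : 1 ≤ ‖cx p‖ := by nlinarith [norm_nonneg (cx p)]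
  have hx2 : 2 < ‖cx p‖ := by nlinarith [norm_nonneg (cx p)]
  have hpow : ‖cx p‖ ≤ ‖cx p‖ ^ (2 * g + 1) := by
    calc ‖cx p‖ = ‖cx p‖ ^ 1 := (pow_one _).symm
      _ ≤ ‖cx p‖ ^ (2 * g + 1) := pow_le_pow_right₀ hx1 (by omega)
  have hw : 1 < ‖w g p‖ := by
    have : w g p = -(cx p ^ (2 * g + 1) + 1) := by simp [w, Phi, hy]; ring
    rw [this, norm_neg]
    have h3 : ‖cx p ^ (2 * g + 1)‖ ≤ ‖cx p ^ (2 * g + 1) + 1‖ + ‖(1 : ℂ)‖ := by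
      have := norm_sub_le (cx p ^ (2 * g + 1) + 1) 1
      rwa [add_sub_cancel_right] at this
    rw [norm_pow, norm_one] at h3
    linarith
  have hw2 : 1 < ‖w g p‖ ^ 2 := by nlinarith
  have hρ := rho_sub_le_profileFamily g hge hτ p
  rw [hF] at hρ
  have : rho g p ≤ 1 / 4 := by linarith
  unfold rho at this
  nlinarith [eta_nonneg (‖cx p‖ ^ 2)]

end Family

/-! ### §4 Compactness of `{rho g ≤ 3/8}` -/

/-- A priori bounds on `{rho g ≤ 3/8}`: `‖x‖² < 6` and `‖w‖² ≤ 3/8`. [folklore] -/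
theorem bounds_of_rho_le_three_eighths (g : ℕ) {p : EuclideanSpace ℝ (Fin 4)} (hp : rho g p ≤ 3 / 8) :
    ‖cx p‖ ^ 2 < 6 ∧ ‖w g p‖ ^ 2 ≤ 3 / 8 := by
  have h1 : ‖w g p‖ ^ 2 ≤ 3 / 8 := by
    unfold rho at hp; nlinarith [eta_nonneg (‖cx p‖ ^ 2)]
  refine ⟨?_, h1⟩
  by_contra h
  rw [not_lt] at h
  have : (1 / 2 : ℝ) ≤ eta (‖cx p‖ ^ 2) := half_le_eta_six.trans (eta_monotone h)
  unfold rho at hp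
  nlinarith [sq_nonneg ‖w g p‖]

/-- `{rho g ≤ 3/8}` is bounded: `‖p‖² ≤ 8 + 3^{4g+2}`. [folklore] -/
theorem norm_sq_le_of_rho_le_three_eighths (g : ℕ) {p : EuclideanSpace ℝ (Fin 4)} (hp : rho g p ≤ 3 / 8) :
    ‖p‖ ^ 2 ≤ 8 + (3 : ℝ) ^ (4 * g + 2) := by
  obtain ⟨hx, hw⟩ := bounds_of_rho_le_three_eighths g hp
  have hx3 : ‖cx p‖ ≤ 3 := by nlinarith [norm_nonneg (cx p)]
  have hwn : ‖w g p‖ ≤ 1 := by nlinarith [norm_nonneg (w g p)]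
  have hy : cy p ^ 2 = w g p + 1 + cx p ^ (2 * g + 1) := by
    simp only [w, Phi]; ring
  have hxn : ‖cx p ^ (2 * g + 1)‖ ≤ (3 : ℝ) ^ (2 * g + 1) := by
    rw [norm_pow]
    exact pow_le_pow_left₀ (norm_nonneg _) hx3 _
  have hy2 : ‖cy p‖ ^ 2 ≤ 2 + (3 : ℝ) ^ (2 * g + 1) := by
    rw [← norm_pow, hy]
    have := norm_add₃_le (a := w g p) (b := (1 : ℂ)) (c := cx p ^ (2 * g + 1))
    rw [norm_one] at this
    linarith
  have h3 : (3 : ℝ) ^ (2 * g + 1) ≤ 3 ^ (4 * g + 2) :=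
    pow_le_pow_right₀ (by norm_num) (by omega)
  rw [norm_sq_eq]
  linarith

/-- `{rho g ≤ 3/8}` is compact. [folklore] -/
theorem isCompact_rho_le_three_eighths (g : ℕ) : IsCompact (rho g ⁻¹' Iic (3 / 8)) := by
  refine Metric.isCompact_of_isClosed_isBounded
    (isClosed_Iic.preimage (contDiff_rho g).continuous) ?_
  rw [isBounded_iff_forall_norm_le]
  refine ⟨8 + (3 : ℝ) ^ (4 * g + 2), fun p hp => ?_⟩
  have h := norm_sq_le_of_rho_le_three_eighths g hp
  have h0 : (0 : ℝ) ≤ 3 ^ (4 * g + 2) := by positivity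
  nlinarith [norm_nonneg p]

/-! ### §5 The profile change -/

/-- **Changing the cut-off profile of the base by a diffeomorphism preserving `w`.**  Let
`η₁ : ℝ → ℝ` be smooth, `η₁ ≥ eta`, `η₁ = eta` on `s ≤ s₀` for some `s₀ > 4`, with
`η₁' > 0` on `s ≥ s₀`.  Then there is a diffeomorphism `Φ` of `ℝ⁴ = ℂ²` with
`Φ {rho g ≤ 1/4} = {‖w‖² + η₁(‖x‖²) ≤ 1/4}`, `Φ {rho g = 1/4} = {‖w‖² + η₁(‖x‖²) = 1/4}`,
preserving `w` (`w ∘ Φ = w`: every page `{w = c}` and the binding `{w = 0}` are carried into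
themselves) and equal to the identity on `{‖x‖² < s₀}` (in particular on the flat part of the
base).  Proof: the directed isotopy lemma `RegularFamily.exists_diffeomorph_image_eq_of_field_on`
for the family `profileFamily g η₁`, the moving set `{‖x‖² ≥ s₀}` and the horizontal field
`horizontalField g ∈ ker dw`. [folklore] -/
theorem exists_diffeomorph_profileChange (g : ℕ) {η₁ : ℝ → ℝ} (hη₁ : ContDiff ℝ ∞ η₁) {s₀ : ℝ}
    (hs₀ : 4 < s₀) (heq : ∀ s, s ≤ s₀ → η₁ s = eta s) (hge : ∀ s, eta s ≤ η₁ s)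
    (hderiv : ∀ s, s₀ ≤ s → 0 < deriv η₁ s) :
    ∃ Φ : EuclideanSpace ℝ (Fin 4) ≃ₘ⟮𝓘(ℝ, EuclideanSpace ℝ (Fin 4)), 𝓘(ℝ, EuclideanSpace ℝ (Fin 4))⟯ EuclideanSpace ℝ (Fin 4),
      Φ '' (rho g ⁻¹' Iic (1 / 4)) = {p | ‖w g p‖ ^ 2 + η₁ (‖cx p‖ ^ 2) ≤ 1 / 4} ∧
      Φ '' (rho g ⁻¹' {1 / 4}) = {p | ‖w g p‖ ^ 2 + η₁ (‖cx p‖ ^ 2) = 1 / 4} ∧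
      (∀ p, w g (Φ p) = w g p) ∧ (∀ p, ‖cx p‖ ^ 2 < s₀ → Φ p = p) := by
  set F := profileFamily g η₁ with hFdef
  have hF : ContDiff ℝ ∞ F := contDiff_profileFamily g hη₁
  have hY : ContDiff ℝ ∞ (horizontalField g) := contDiff_horizontalField g
  set K : Set (EuclideanSpace ℝ (Fin 4)) := rho g ⁻¹' Iic (3 / 8) with hK
  have hKc : IsCompact K := isCompact_rho_le_three_eighths g
  set C : Set (EuclideanSpace ℝ (Fin 4)) := {p | s₀ ≤ ‖cx p‖ ^ 2} with hC
  have hCc : IsClosed C :=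
    isClosed_le continuous_const ((continuous_norm.comp contDiff_cx.continuous).pow 2)
  have hε₀ : (0 : ℝ) < 1 / 8 := by norm_num
  -- the band lies in `K`
  have hKF : ∀ τ ∈ Icc (0 : ℝ) 1, ∀ p, |F (τ, p)| ≤ 1 / 8 → p ∈ K := by
    intro τ hτ p hp
    have h1 := rho_sub_le_profileFamily g hge hτ.1 p
    have h2 := (abs_le.1 hp).2
    show rho g p ≤ 3 / 8
    linarith
  -- off `C` nothing moves
  have hstat : ∀ τ ∈ Icc (0 : ℝ) 1, ∀ p, p ∉ C → fderiv ℝ F (τ, p) (1, 0) = 0 := by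
    intro τ _ p hp
    have hp' : ‖cx p‖ ^ 2 < s₀ := not_le.1 hp
    rw [hFdef, fderiv_profileFamily_time g hη₁ τ p, heq _ hp'.le, sub_self]
  -- transversality on the moving part of the zero sets
  have hreg : ∀ τ ∈ Icc (0 : ℝ) 1, ∀ p ∈ C, F (τ, p) = 0 →
      fderiv ℝ (fun q => F (τ, q)) p (horizontalField g p) ≠ 0 := by
    intro τ hτ p hpC hp0
    have hx4 : 4 < ‖cx p‖ ^ 2 := hs₀.trans_le hpC
    have hy : cy p ≠ 0 := cy_ne_zero_of_profileFamily_eq_zero g hge hτ.1 hp0 hx4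
    rw [hFdef, fderiv_profileFamily_horizontalField g hη₁ τ p]
    have h1 : 0 < deriv eta (‖cx p‖ ^ 2) := deriv_eta_pos hx4
    have h2 : 0 < deriv η₁ (‖cx p‖ ^ 2) := hderiv _ hpC
    have h3 : 0 < (1 - τ) * deriv eta (‖cx p‖ ^ 2) + τ * deriv η₁ (‖cx p‖ ^ 2) := by
      rcases eq_or_lt_of_le hτ.1 with h0 | h0
      · rw [← h0]; simpa using h1
      · have : 0 ≤ (1 - τ) * deriv eta (‖cx p‖ ^ 2) := mul_nonneg (by linarith [hτ.2]) h1.le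
        nlinarith
    have hxpos : 0 < ‖cx p‖ ^ 2 := by linarith
    have hypos : 0 < ‖cy p‖ ^ 2 := by positivity
    have h4 : 0 < 4 * ‖cx p‖ ^ 2 * ‖cy p‖ ^ 2 := by positivity
    nlinarith
  obtain ⟨Φ, hle, heq', -, -, hfixC, -, horb⟩ :=
    RegularFamily.exists_diffeomorph_image_eq_of_field_on hF hY hKc hCc hε₀ hKF hstat hreg
  refine ⟨Φ, ?_, ?_, fun p => ?_, fun p hp => hfixC p (not_le.2 hp)⟩
  · -- the sublevel sets
    have h0 : {p : EuclideanSpace ℝ (Fin 4) | F (0, p) ≤ 0} = rho g ⁻¹' Iic (1 / 4) := by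
      ext p
      simp only [mem_setOf_eq, mem_preimage, mem_Iic, hFdef, profileFamily_zero]
      constructor <;> intro h <;> linarith
    have h1 : {p : EuclideanSpace ℝ (Fin 4) | F (1, p) ≤ 0} = {p | ‖w g p‖ ^ 2 + η₁ (‖cx p‖ ^ 2) ≤ 1 / 4} := by
      ext p
      simp only [mem_setOf_eq, hFdef, profileFamily_one]
      constructor <;> intro h <;> linarith
    rw [← h0, ← h1]
    exact hle
  · -- the level sets
    have h0 : {p : EuclideanSpace ℝ (Fin 4) | F (0, p) = 0} = rho g ⁻¹' {1 / 4} := by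
      ext p
      simp only [mem_setOf_eq, mem_preimage, mem_singleton_iff, hFdef, profileFamily_zero]
      constructor <;> intro h <;> linarith
    have h1 : {p : EuclideanSpace ℝ (Fin 4) | F (1, p) = 0} = {p | ‖w g p‖ ^ 2 + η₁ (‖cx p‖ ^ 2) = 1 / 4} := by
      ext p
      simp only [mem_setOf_eq, hFdef, profileFamily_one]
      constructor <;> intro h <;> linarith
    rw [← h0, ← h1]
    exact heq'
  · -- `w` is a conserved quantity of the horizontal field
    obtain ⟨γ, κ, -, hγ0, hγ1, hγ⟩ := horb p
    rw [← hγ1, ← hγ0]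
    exact RegularFamily.apply_eq_apply_of_hasDerivAt_smul
      ((contDiff_w g).differentiable (by simp)) (fderiv_w_horizontalField g) hγ 1

end LefschetzBase

end Literature.Topology.FourManifolds

end
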